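import Literature.NumberTheory.Automorphic.PairLFunctionPolesRankNeLandau
import HarnessLib

/-!
# Arthur–Clozel (2.2) at `s = 1`, `n ≠ m`: split record (Mœglin–Waldspurger continuation)

Topic `NumberTheory/Automorphic`; namespace `Literature.NumberTheory.Automorphic`. Split record
(librarian, fact-decompose) for the named fact
`Literature.NumberTheory.Automorphic.JacquetShalika1981_partialPairL_at_one_of_rank_ne`
(`PairLFunctionPoles.lean`: Arthur–Clozel, *Simple algebras, base change, and the advanced theory
of the trace formula*, Ann. of Math. Stud. 120 (1989), Ch. 3 §2, (2.2) at `s₀ = 1` for cuspidal `π`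
on `GL_n(𝔸_K)`, `σ` on `GL_m(𝔸_K)`, `n ≠ m`: `L^S(s, π ⊗ σ)` has a finite NON-ZERO limit as `s → 1`,
`Re s > 1`).

In print the two halves are (A) the holomorphic continuation of `L(s, π × σ)` (Jacquet–Piatetski-
Shapiro–Shalika; Mœglin–Waldspurger, Appendice, Corollaire) and (B) Shahidi's non-vanishing on
`Re s = 1`. The tree PROVES the fact from the continuation alone
(`JacquetShalika1981_partialPairL_at_one_of_rank_ne_of_moeglinWaldspurger`,
`PairLFunctionPolesRankNeLandau.lean`: de la Vallée Poussin's positivity argument in its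
Rankin–Selberg form for the family `α ⊞ β̄`, with Landau's lemma and the unitarity of central
characters, replaces (B)). The children of this split are therefore the two EXISTING named facts of
`PairLFunctionMeromorphicContinuation.lean`:

1. `Literature.NumberTheory.Automorphic.MoeglinWaldspurger1989_partialPairL_entire_of_rank_ne` —
   Corollaire (i)(a): `L^S(s, π ⊗ σ)` is entire for `n ≠ m` (used at the ranks `(n, m)`);
2. `Literature.NumberTheory.Automorphic.MoeglinWaldspurger1989_partialPairL_of_eq_conj` —
   Corollaire (ii): `s (s - 1) L^S(s, π ⊗ π̃)` is entire (used at rank `n` and at rank `m`).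

Assembly (PROVED): `JacquetShalika1981_partialPairL_at_one_of_rank_ne_holds_of`. Neither child
restates the parent (both are continuation statements with no claim at `s = 1`; the parent is a
non-vanishing statement). No definition, no new named fact.

## References

* J. Arthur, L. Clozel, Ann. of Math. Stud. 120 (1989), Ch. 3 §2, (2.2), p. 171. [ArthurClozelAMS120]
* C. Mœglin, J.-L. Waldspurger, *Le spectre résiduel de `GL(n)`*, Ann. Sci. ÉNS (4) 22 (1989),
  Appendice, Corollaire (i)(a), (ii), p. 667. [MoeglinWaldspurger1989]
* S. Gelbart, *When is an `L`-function non-vanishing in part of the critical strip?* (2007), §2.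
  [Gelbart2007Nonvanishing]
-/

noncomputable section

open scoped Topology
open NumberField IsDedekindDomain MeasureTheory Filter Complex

namespace Literature.NumberTheory.Automorphic

open AdelicGroupData

variable {K : Type} [Field K] [NumberField K]
variable {n m : ℕ} {μ : Measure (gl n K).automorphicQuotient} [(gl n K).IsAutomorphicMeasure μ]
  {μ' : Measure (gl m K).automorphicQuotient} [(gl m K).IsAutomorphicMeasure μ']

/-- **Split assembly for Arthur–Clozel (2.2) at `s₀ = 1`, `n ≠ m`**: the named fact
`JacquetShalika1981_partialPairL_at_one_of_rank_ne` (at ranks `n, m`, field `K`, measures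
`μ, μ'`) follows from the Mœglin–Waldspurger continuation facts — Corollaire (i)(a) at `(n, m)`
and Corollaire (ii) at rank `n` and at rank `m` — by
`JacquetShalika1981_partialPairL_at_one_of_rank_ne_of_moeglinWaldspurger` (positivity + Landau in
place of Shahidi's theorem). [cite: ArthurClozelAMS120, Ch. 3 §2 (2.2)]
[cite: MoeglinWaldspurger1989, Appendice, Corollaire (i)(a), (ii), p. 667] -/
theorem JacquetShalika1981_partialPairL_at_one_of_rank_ne_holds_of
    (h₁ : MoeglinWaldspurger1989_partialPairL_entire_of_rank_ne (n := n) (m := m) (K := K) (μ := μ)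
      (μ' := μ'))
    (h₂ : MoeglinWaldspurger1989_partialPairL_of_eq_conj (n := n) (K := K) (μ := μ))
    (h₂' : MoeglinWaldspurger1989_partialPairL_of_eq_conj (n := m) (K := K) (μ := μ')) :
    JacquetShalika1981_partialPairL_at_one_of_rank_ne (n := n) (m := m) (K := K) (μ := μ)
      (μ' := μ') :=
  JacquetShalika1981_partialPairL_at_one_of_rank_ne_of_moeglinWaldspurger h₁ h₂ h₂'

end Literature.NumberTheory.Automorphic

end
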